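import Mathlib.Algebra.CubicDiscriminant
import Mathlib.Analysis.Complex.Polynomial.Basic
import HarnessLib

/-!
# The number of real roots of a real cubic is read off from the sign of its discriminant

For a real cubic `P = aX³ + bX² + cX + d`, `a ≠ 0`, with discriminant
`D = b²c² − 4ac³ − 4b³d − 27a²d² + 18abcd` (Mathlib's `Cubic.discr`):

* `card_roots_eq_three_of_discr_pos`: if `D > 0` then `P` has three distinct real roots;
* `card_roots_eq_one_of_discr_neg`: if `D < 0` then `P` has exactly one real root;
* `discr_pos_iff_card_roots_eq_three`, `discr_neg_iff_card_roots_eq_one` (for `D ≠ 0`).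

Proof: over `ℂ` the cubic splits with roots `x, y, z` and `D = (a²(x−y)(x−z)(y−z))²`
(`Cubic.discr_eq_prod_three_roots`); complex conjugation permutes the roots, so either all three
are real — then `a²(x−y)(x−z)(y−z)` is real and `D > 0` — or exactly one is real and the other
two are conjugate — then `a²(x−y)(x−z)(y−z)` is purely imaginary and `D < 0`
(`roots_real_or_conj_pair`).

Used for the constants `n₀ = n₂ = 4`, `n₁ = 2` (orders of real stabilisers, Lemma 2.2) in
Bhargava–Shankar's count of binary quartic forms, where the cubic is the resolvent `φ³ − 3Iφ + J`
of discriminant `27²·Δ`. Mathlib has the discriminant, its expression through the roots and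
`Cubic.card_roots_of_discr_ne_zero` over a splitting field, but not this real statement (searched
`discr`, `roots`, `real`).

## References

* Classical (Cardano); e.g. D. S. Dummit, R. M. Foote, *Abstract Algebra*, 3rd ed., §14.6 (a real
  cubic has three real roots iff its discriminant is positive). [folklore]
-/

noncomputable section

open Polynomial Complex
open scoped ComplexConjugate

namespace Literature.Algebra.Polynomial

variable {P : Cubic ℝ}

/-- The complex cubic `P ⊗ ℂ` has leading coefficient `a ≠ 0`. [folklore] -/
theorem map_a_ne_zero (ha : P.a ≠ 0) : (Cubic.map ofRealHom P).a ≠ 0 := by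
  simpa [Cubic.map] using ha

/-- Membership in the complex roots of a real cubic, spelled out. [folklore] -/
theorem mem_roots_map_iff (ha : P.a ≠ 0) (u : ℂ) :
    u ∈ (Cubic.map ofRealHom P).roots ↔
      (P.a : ℂ) * u ^ 3 + (P.b : ℂ) * u ^ 2 + (P.c : ℂ) * u + (P.d : ℂ) = 0 := by
  rw [Cubic.mem_roots_iff (Cubic.ne_zero_of_a_ne_zero (map_a_ne_zero ha))]
  simp [Cubic.map]

/-- A real number is a root of `P` iff it is a complex root of `P ⊗ ℂ`. [folklore] -/
theorem mem_roots_iff_coe_mem (ha : P.a ≠ 0) (r : ℝ) :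
    r ∈ P.roots ↔ (r : ℂ) ∈ (Cubic.map ofRealHom P).roots := by
  rw [Cubic.mem_roots_iff (Cubic.ne_zero_of_a_ne_zero ha), mem_roots_map_iff ha]
  constructor
  · intro h; exact_mod_cast h
  · intro h; exact_mod_cast h

/-- **Complex conjugation permutes the complex roots of a real cubic.** [folklore] -/
theorem conj_mem_roots_map (ha : P.a ≠ 0) {u : ℂ} (hu : u ∈ (Cubic.map ofRealHom P).roots) :
    conj u ∈ (Cubic.map ofRealHom P).roots := by
  rw [mem_roots_map_iff ha] at hu ⊢
  have := congrArg conj hu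
  simpa using this

/-- A complex root fixed by conjugation is (the image of) a real root. [folklore] -/
theorem re_mem_roots_of_conj_eq (ha : P.a ≠ 0) {u : ℂ} (hu : u ∈ (Cubic.map ofRealHom P).roots)
    (hc : conj u = u) : u.re ∈ P.roots := by
  rw [mem_roots_iff_coe_mem ha, conj_eq_iff_re.mp hc]
  exact hu

/-- `{x, y, z} = {z, x, y}` as multisets. [folklore] -/
theorem multiset_triple_rotate {α : Type*} (x y z : α) :
    ({x, y, z} : Multiset α) = {z, x, y} := by
  simp only [Multiset.insert_eq_cons, ← Multiset.singleton_add]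
  abel

/-- `{x, y, z} = {y, x, z}` as multisets. [folklore] -/
theorem multiset_triple_swap {α : Type*} (x y z : α) :
    ({x, y, z} : Multiset α) = {y, x, z} := by
  simp only [Multiset.insert_eq_cons, ← Multiset.singleton_add]
  abel

/-- **The root pattern of a real cubic with distinct roots**: either all three complex roots are
real, or one is real and the other two are complex conjugates of each other. [folklore] -/
theorem roots_real_or_conj_pair (ha : P.a ≠ 0) {x y z : ℂ} (h3 : (Cubic.map ofRealHom P).roots = {x, y, z})
    (hxy : x ≠ y) (hxz : x ≠ z) (hyz : y ≠ z) :
    (conj x = x ∧ conj y = y ∧ conj z = z) ∨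
      ∃ t u : ℂ, conj t = t ∧ conj u ≠ u ∧ (Cubic.map ofRealHom P).roots = {t, u, conj u} := by
  have hmem : ∀ w : ℂ, w ∈ (Cubic.map ofRealHom P).roots ↔ w = x ∨ w = y ∨ w = z := by
    intro w; rw [h3]; simp
  have hx := (hmem _).mp (conj_mem_roots_map ha ((hmem x).mpr (Or.inl rfl)))
  have hy := (hmem _).mp (conj_mem_roots_map ha ((hmem y).mpr (Or.inr (Or.inl rfl))))
  have hz := (hmem _).mp (conj_mem_roots_map ha ((hmem z).mpr (Or.inr (Or.inr rfl))))
  have hcc : ∀ w : ℂ, conj (conj w) = w := fun w ↦ Complex.conj_conj w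
  -- `conj a = b` gives `a = conj b`
  have flip : ∀ {a b : ℂ}, conj a = b → a = conj b := fun {a b} h ↦ by rw [← h, hcc]
  by_cases hxr : conj x = x
  · by_cases hyr : conj y = y
    · have hzr : conj z = z := by
        rcases hz with h | h | h
        · exact absurd ((flip h).trans hxr).symm hxz
        · exact absurd ((flip h).trans hyr).symm hyz
        · exact h
      exact Or.inl ⟨hxr, hyr, hzr⟩
    · have hyz' : conj y = z := by
        rcases hy with h | h | h
        · exact absurd ((flip h).trans hxr).symm hxy
        · exact absurd h hyr
        · exact h
      refine Or.inr ⟨x, y, hxr, hyr, ?_⟩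
      rw [h3, hyz']
  · rcases hx with h | h | h
    · exact absurd h hxr
    · -- `conj x = y`: then `conj y = x` and `z` is real
      have hyx : conj y = x := by rw [← h, hcc]
      have hzr : conj z = z := by
        rcases hz with h' | h' | h'
        · exact absurd ((flip h').trans h) hyz.symm
        · exact absurd ((flip h').trans hyx) hxz.symm
        · exact h'
      refine Or.inr ⟨z, x, hzr, hxr, ?_⟩
      rw [h3, h]
      exact multiset_triple_rotate x y z
    · -- `conj x = z`: then `conj z = x` and `y` is real
      have hzx : conj z = x := by rw [← h, hcc]
      have hyr : conj y = y := by
        rcases hy with h' | h' | h'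
        · exact absurd ((flip h').trans h) hyz
        · exact h'
        · exact absurd ((flip h').trans hzx) hxy.symm
      refine Or.inr ⟨y, x, hyr, hxr, ?_⟩
      rw [h3, h]
      exact multiset_triple_swap x y z

/-- For a conjugation-fixed `x`, a real `r` has `↑r = x` iff `r = x.re`. [folklore] -/
theorem coe_eq_iff_eq_re {x : ℂ} (hx : conj x = x) (r : ℝ) : (r : ℂ) = x ↔ r = x.re := by
  constructor
  · intro h; rw [← h, ofReal_re]
  · intro h; rw [h]; exact conj_eq_iff_re.mp hx

/-- **All roots real ⇒ `D > 0`** (`D = (a²(x−y)(x−z)(y−z))²` with a real nonzero base). [folklore] -/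
theorem discr_pos_of_roots_real (ha : P.a ≠ 0) {x y z : ℂ}
    (h3 : (Cubic.map ofRealHom P).roots = {x, y, z}) (hxy : x ≠ y) (hxz : x ≠ z) (hyz : y ≠ z)
    (hx : conj x = x) (hy : conj y = y) (hz : conj z = z) : 0 < P.discr := by
  obtain ⟨x, rfl⟩ : ∃ r : ℝ, (r : ℂ) = x := ⟨x.re, conj_eq_iff_re.mp hx⟩
  obtain ⟨y, rfl⟩ : ∃ r : ℝ, (r : ℂ) = y := ⟨y.re, conj_eq_iff_re.mp hy⟩
  obtain ⟨z, rfl⟩ : ∃ r : ℝ, (r : ℂ) = z := ⟨z.re, conj_eq_iff_re.mp hz⟩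
  have hd := Cubic.discr_eq_prod_three_roots (φ := ofRealHom) ha h3
  simp only [ofRealHom_eq_coe] at hd
  have hd' : P.discr = (P.a * P.a * (x - y) * (x - z) * (y - z)) ^ 2 := by
    exact_mod_cast hd
  rw [hd']
  have hxy' : x ≠ y := fun h ↦ hxy (by rw [h])
  have hxz' : x ≠ z := fun h ↦ hxz (by rw [h])
  have hyz' : y ≠ z := fun h ↦ hyz (by rw [h])
  have hne : P.a * P.a * (x - y) * (x - z) * (y - z) ≠ 0 :=
    mul_ne_zero (mul_ne_zero (mul_ne_zero (mul_ne_zero ha ha) (sub_ne_zero.mpr hxy'))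
      (sub_ne_zero.mpr hxz')) (sub_ne_zero.mpr hyz')
  positivity

/-- **One real root and a conjugate pair ⇒ `D < 0`** (`a²(t−u)(t−ū)(u−ū)` is purely imaginary).
[folklore] -/
theorem discr_neg_of_conj_pair (ha : P.a ≠ 0) {t u : ℂ}
    (h3 : (Cubic.map ofRealHom P).roots = {t, u, conj u}) (ht : conj t = t) (hu : conj u ≠ u) :
    P.discr < 0 := by
  obtain ⟨s, rfl⟩ : ∃ r : ℝ, (r : ℂ) = t := ⟨t.re, conj_eq_iff_re.mp ht⟩
  obtain ⟨p, q, rfl⟩ : ∃ p q : ℝ, (p : ℂ) + (q : ℂ) * I = u := ⟨u.re, u.im, re_add_im u⟩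
  have hconj : conj ((p : ℂ) + (q : ℂ) * I) = (p : ℂ) - (q : ℂ) * I := by
    simp only [map_add, map_mul, conj_ofReal, conj_I]; ring
  have hq : q ≠ 0 := by
    intro h0
    apply hu
    rw [hconj, h0]; push_cast; ring
  rw [hconj] at h3
  have hd := Cubic.discr_eq_prod_three_roots (φ := ofRealHom) ha h3
  simp only [ofRealHom_eq_coe] at hd
  have hw : (P.a : ℂ) * P.a * ((s : ℂ) - ((p : ℂ) + (q : ℂ) * I)) * ((s : ℂ) - ((p : ℂ) - (q : ℂ) * I)) *
      ((p : ℂ) + (q : ℂ) * I - ((p : ℂ) - (q : ℂ) * I)) =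
        ((2 * (P.a * P.a) * q * ((s - p) ^ 2 + q ^ 2) : ℝ) : ℂ) * I := by
    push_cast
    linear_combination (-2 * ((P.a : ℂ) * P.a) * q ^ 3 * I) * I_mul_I
  have key : (P.discr : ℂ) = -(((2 * (P.a * P.a) * q * ((s - p) ^ 2 + q ^ 2)) ^ 2 : ℝ) : ℂ) := by
    rw [hd, hw, mul_pow, I_sq]
    push_cast
    ring
  have key' : P.discr = -((2 * (P.a * P.a) * q * ((s - p) ^ 2 + q ^ 2)) ^ 2) := by
    exact_mod_cast key
  rw [key']
  have hne : 2 * (P.a * P.a) * q * ((s - p) ^ 2 + q ^ 2) ≠ 0 := by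
    refine mul_ne_zero (mul_ne_zero (mul_ne_zero two_ne_zero (mul_ne_zero ha ha)) hq) ?_
    positivity
  have : 0 < (2 * (P.a * P.a) * q * ((s - p) ^ 2 + q ^ 2)) ^ 2 := by positivity
  linarith

/-- **A real cubic with `D > 0` has three distinct real roots.** [folklore] -/
theorem card_roots_eq_three_of_discr_pos (ha : P.a ≠ 0) (hD : 0 < P.discr) :
    P.roots.toFinset.card = 3 := by
  classical
  have hsplit : (P.toPoly.map ofRealHom).Splits := IsAlgClosed.splits _
  obtain ⟨x, y, z, h3⟩ := (Cubic.splits_iff_roots_eq_three ha).mp hsplit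
  obtain ⟨hxy, hxz, hyz⟩ := (Cubic.discr_ne_zero_iff_roots_ne ha h3).mp hD.ne'
  rcases roots_real_or_conj_pair ha h3 hxy hxz hyz with ⟨hx, hy, hz⟩ | ⟨t, u, ht, hu, h3'⟩
  · have hroots : P.roots.toFinset = {x.re, y.re, z.re} := by
      ext r
      rw [Multiset.mem_toFinset, mem_roots_iff_coe_mem ha, h3]
      simp only [Multiset.insert_eq_cons, Multiset.mem_cons, Multiset.mem_singleton,
        Finset.mem_insert, Finset.mem_singleton, coe_eq_iff_eq_re hx, coe_eq_iff_eq_re hy,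
        coe_eq_iff_eq_re hz]
    have hxy' : x.re ≠ y.re := fun h ↦ hxy (by
      rw [← conj_eq_iff_re.mp hx, ← conj_eq_iff_re.mp hy, h])
    have hxz' : x.re ≠ z.re := fun h ↦ hxz (by
      rw [← conj_eq_iff_re.mp hx, ← conj_eq_iff_re.mp hz, h])
    have hyz' : y.re ≠ z.re := fun h ↦ hyz (by
      rw [← conj_eq_iff_re.mp hy, ← conj_eq_iff_re.mp hz, h])
    rw [hroots, Finset.card_insert_of_notMem (by simp [hxy', hxz']),
      Finset.card_insert_of_notMem (by simp [hyz']), Finset.card_singleton]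
  · exact absurd hD (not_lt.mpr (discr_neg_of_conj_pair ha h3' ht hu).le)

/-- **A real cubic with `D < 0` has exactly one real root.** [folklore] -/
theorem card_roots_eq_one_of_discr_neg (ha : P.a ≠ 0) (hD : P.discr < 0) :
    P.roots.toFinset.card = 1 := by
  classical
  have hsplit : (P.toPoly.map ofRealHom).Splits := IsAlgClosed.splits _
  obtain ⟨x, y, z, h3⟩ := (Cubic.splits_iff_roots_eq_three ha).mp hsplit
  obtain ⟨hxy, hxz, hyz⟩ := (Cubic.discr_ne_zero_iff_roots_ne ha h3).mp hD.ne
  rcases roots_real_or_conj_pair ha h3 hxy hxz hyz with ⟨hx, hy, hz⟩ | ⟨t, u, ht, hu, h3'⟩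
  · exact absurd hD (not_lt.mpr (discr_pos_of_roots_real ha h3 hxy hxz hyz hx hy hz).le)
  · have hroots : P.roots.toFinset = {t.re} := by
      ext r
      rw [Multiset.mem_toFinset, mem_roots_iff_coe_mem ha, h3', Finset.mem_singleton]
      simp only [Multiset.insert_eq_cons, Multiset.mem_cons, Multiset.mem_singleton,
        coe_eq_iff_eq_re ht]
      constructor
      · rintro (h | h | h)
        · exact h
        · exact absurd (by rw [← h, conj_ofReal]) hu
        · have h1 : u = (r : ℂ) := by rw [← Complex.conj_conj u, ← h, conj_ofReal]
          exact absurd (by rw [h1, conj_ofReal]) hu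
      · intro h
        exact Or.inl h
    rw [hroots, Finset.card_singleton]

/-- **`D > 0` iff three real roots**, for a real cubic with `D ≠ 0`. [folklore] -/
theorem discr_pos_iff_card_roots_eq_three (ha : P.a ≠ 0) (hD : P.discr ≠ 0) :
    0 < P.discr ↔ P.roots.toFinset.card = 3 := by
  constructor
  · exact card_roots_eq_three_of_discr_pos ha
  · intro h3
    rcases hD.lt_or_gt with hlt | hgt
    · have := card_roots_eq_one_of_discr_neg ha hlt; omega
    · exact hgt

/-- **`D < 0` iff exactly one real root**, for a real cubic with `D ≠ 0`. [folklore] -/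
theorem discr_neg_iff_card_roots_eq_one (ha : P.a ≠ 0) (hD : P.discr ≠ 0) :
    P.discr < 0 ↔ P.roots.toFinset.card = 1 := by
  constructor
  · exact card_roots_eq_one_of_discr_neg ha
  · intro h1
    rcases hD.lt_or_gt with hlt | hgt
    · exact hlt
    · have := card_roots_eq_three_of_discr_pos ha hgt; omega

end Literature.Algebra.Polynomial

end
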